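import Literature.MathematicalPhysics.QuantumFieldTheory.BalabanImbrieJaffe1984to88.BIJ88TwoSpeciesPolymerGas
import Literature.Probability.LatticeModels.ClusterExpansion
import Literature.Probability.LatticeModels.PolymerGasGeometric

/-!
# `BalabanImbrieJaffe1984to88.BIJ88TypedGasKP` — T. Bałaban, J. Imbrie, A. Jaffe, *Effective action and cluster properties of the abelian
Higgs model*, Commun. Math. Phys. **114** (1988) 257–315 [BalabanImbrieJaffe1988], §5.14 p. 310 [PDF 54], verbatim: *"It is now a standard
exercise to estimate the expansion, using (5.14.4)."* — **the standard exercise, made precise for the HONEST TYPED GAS**: the Kotecký–Preiss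
condition for the gas of typed polymers of `BIJ88TwoSpeciesPolymerGas` (incompatibility `tinc adj`: same or overlapping support, or both of
species B and abutting) FROM AN ACTIVITY BOUND `‖ŵ(X,τ)‖ ≤ ε^{#X}` on `adj`-connected supports, uniformly in the volume.

statement-level skeleton of published theorems with citation tags; proofs where landed; nothing here is a claim about the Yang–Mills mass gap

PDF held: `paper:balaban1988-cmp114-bij-abelian-higgs-effective-action` (journal page = PDF page + 256); p. 310 = PDF 54 (text `p0054.txt` L25).

WHAT IS REPRODUCED (unit `lit-balaban-p25`, generation 9 of the Phase-2 proof seat p25; SKELETON rows `C2.Eq5.14.1-5.14.2` / `C2.Claim@310`;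
HOME `run/shared/lean/pub/lit-balaban/lit-balaban-p25/`), theorems only. HYPOTHESES (all explicit; the paper's input (5.14.4) is an estimate
of this type and is NOT reproduced here): the cube adjacency `adj` is symmetric with at most `Δ` neighbours per cube (listed by `nbr`); the
activity `ŵ` of the typed polymers vanishes unless the support is `adj`-connected and obeys `‖ŵ(X,τ)‖ ≤ ε^{#X}`; `ε ≥ 0` is small:
`e ε (Δ+1)² ≤ 1/2` and `4 e ε (Δ+1) ≤ 1`. CONCLUSION (`isKPVolume_typedGas`): for EVERY finite family `Λ` of typed polymers,
`IsKPVolume (tinc adj) ŵ (fun p => #p.1) Λ` — the hypothesis `hKP` of `BIJ88TypedGasLogZ308` (`exp(log z)`, `log z = Σ_clusters Φ^T`,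
ratios through clusters), with the size function `a(X,τ) = #X`. Steps: `touches_of_tinc` (incompatible typed polymers have equal or
TOUCHING supports — this is where the B–B abutting clause enters, at no cost), `kpTerm_le_kpWeight` (`‖ŵ‖e^{#X} ≤ (eε)^{#X}` on connected
supports), the lattice-animal bound of `Literature.Probability.LatticeModels.PolymerGasGeometric` (`sum_kpWeight_le_of_touches`: the
`(eε)^{#Y}`-weight of the connected sets touching `X` is `≤ #X (Δ+1) · 2eε`), and a factor `2` for the two species
(`sum_typed_le_two_mul`).

Reading note: none beyond GAPS.md G-C2-p25-03 — for the honest gas the *"standard exercise"* is literally the standard one (finer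
incompatibility = touching, which the animal bound already covers). NOT summit progress; NOT continuum; NOT Clay; (5.14.4) itself is not
asserted. Imports: `BIJ88TwoSpeciesPolymerGas`, `LatticeModels.ClusterExpansion`, `LatticeModels.PolymerGasGeometric`; modifies nothing.
Cell `lit-balaban` Phase 2, seat p25 gen 9 (owner r16, referee ref-5).
-/

open Finset
open Literature.Probability.LatticeModels (IsKPVolume kpTerm IsRConnected Touches kpWeight kpWeight_nonneg sum_kpWeight_le_of_touches)
open Literature.MathematicalPhysics.QuantumFieldTheory.BalabanImbrieJaffe1984to88.BIJ88TwoSpeciesPolymerGas (tinc Touch)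

namespace Literature.MathematicalPhysics.QuantumFieldTheory.BalabanImbrieJaffe1984to88.BIJ88TypedGasKP

variable {ι : Type*} [DecidableEq ι] {adj : ι → ι → Prop} [DecidableRel adj] {nbr : ι → Finset ι} {Δ : ℕ}

omit [DecidableEq ι] [DecidableRel adj] in
/-- **incompatible typed polymers have equal or touching supports** (overlap ⇒ a common cube; B–B abutting ⇒ adjacent cubes): the finer
incompatibility of the honest gas is covered by the geometric "touching" of the animal bounds. [cite: BalabanImbrieJaffe1988, p.310 (Sect. 5.14)] -/
theorem touches_of_tinc (hR : ∀ x y, adj x y → adj y x) {p q : Finset ι × Bool} (h : tinc adj q p) :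
    q.1 = p.1 ∨ Touches adj p.1 q.1 := by
  rcases h with h | h | ⟨-, -, a, ha, b, hb, hab⟩
  · exact Or.inl h
  · obtain ⟨c, hcq, hcp⟩ := not_disjoint_iff.1 h
    exact Or.inr ⟨c, hcp, c, hcq, Or.inl rfl⟩
  · exact Or.inr ⟨b, hb, a, ha, Or.inr (hab.elim (hR a b) id)⟩

omit [DecidableEq ι] [DecidableRel adj] in
/-- **the KP term of a typed polymer is at most the animal weight of its support**: with the size function `a(X,τ) = #X` and
`‖ŵ(X,τ)‖ ≤ ε^{#X}` on connected supports (`0` elsewhere), `‖ŵ(X,τ)‖ e^{#X} ≤ (eε)^{#X} · 𝟙[X connected] = kpWeight adj (eε) X`.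
[cite: BalabanImbrieJaffe1988, p.310 (Sect. 5.14)] -/
theorem kpTerm_le_kpWeight {w : Finset ι × Bool → ℂ} {ε : ℝ} (hz0 : ∀ p, ¬ IsRConnected adj p.1 → w p = 0)
    (hz : ∀ p, ‖w p‖ ≤ ε ^ p.1.card) (p : Finset ι × Bool) :
    kpTerm w (fun p => (p.1.card : ℝ)) p ≤ kpWeight adj (Real.exp 1 * ε) p.1 := by
  simp only [kpTerm]
  by_cases hc : IsRConnected adj p.1
  · rw [kpWeight, if_pos hc, mul_pow, Real.exp_one_pow, mul_comm]
    exact mul_le_mul_of_nonneg_left (hz p) (Real.exp_pos _).le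
  · rw [kpWeight, if_neg hc, hz0 p hc, norm_zero, zero_mul]

omit [DecidableRel adj] in
/-- summing a function of the support over a family of typed polymers costs at most a factor `2` (two species per support).
[cite: BalabanImbrieJaffe1988, (5.13.4) p.306] -/
theorem sum_typed_le_two_mul {f : Finset ι → ℝ} (hf : ∀ X, 0 ≤ f X) (F : Finset (Finset ι × Bool)) :
    ∑ q ∈ F, f q.1 ≤ 2 * ∑ X ∈ F.image Prod.fst, f X := by
  calc ∑ q ∈ F, f q.1 ≤ ∑ q ∈ F.image Prod.fst ×ˢ (univ : Finset Bool), f q.1 :=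
        sum_le_sum_of_subset_of_nonneg (fun q hq => mem_product.2 ⟨mem_image_of_mem _ hq, mem_univ _⟩) fun q _ _ => hf q.1
    _ = 2 * ∑ X ∈ F.image Prod.fst, f X := by
        rw [sum_product, mul_sum]
        refine sum_congr rfl fun X _ => ?_
        simp only [sum_const, card_univ, Fintype.card_bool, nsmul_eq_mul, Nat.cast_ofNat]

/-- **THE STANDARD EXERCISE FOR THE HONEST TYPED GAS — the Kotecký–Preiss condition from an activity bound, uniformly in the volume**: if the
cube adjacency is symmetric of degree `≤ Δ`, the typed activities vanish off `adj`-connected supports and satisfy `‖ŵ(X,τ)‖ ≤ ε^{#X}` with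
`e ε (Δ+1)² ≤ 1/2` and `4 e ε (Δ+1) ≤ 1`, then EVERY finite family of typed polymers is a KP volume for the incompatibility `tinc adj` and the
size function `a(X,τ) = #X`: `Σ_{(Y,σ) incompatible with (X,τ)} ‖ŵ(Y,σ)‖ e^{#Y} ≤ 2 · #X (Δ+1) · 2eε ≤ #X`.
[cite: BalabanImbrieJaffe1988, p.310 (Sect. 5.14)] -/
theorem isKPVolume_typedGas (hR : ∀ x y, adj x y → adj y x) (hΔ : ∀ x, (nbr x).card ≤ Δ) (hnbr : ∀ x y, adj x y → y ∈ nbr x)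
    {ε : ℝ} (hε : 0 ≤ ε) (hsmall₁ : Real.exp 1 * ε * ((Δ : ℝ) + 1) ^ 2 ≤ 1 / 2) (hsmall₂ : 4 * Real.exp 1 * ε * ((Δ : ℝ) + 1) ≤ 1)
    {w : Finset ι × Bool → ℂ} (hz0 : ∀ p, ¬ IsRConnected adj p.1 → w p = 0) (hz : ∀ p, ‖w p‖ ≤ ε ^ p.1.card)
    (Λ : Finset (Finset ι × Bool)) : IsKPVolume (tinc adj) w (fun p => (p.1.card : ℝ)) Λ := by
  intro p _
  set lam : ℝ := Real.exp 1 * ε with hlam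
  have hlam0 : 0 ≤ lam := mul_nonneg (Real.exp_pos 1).le hε
  have hsmall₁' : ((Δ : ℝ) + 1) ^ 2 * lam ≤ 1 / 2 := by rw [hlam]; linarith [hsmall₁]
  set F : Finset (Finset ι × Bool) := Λ.filter fun q => tinc adj q p with hF
  have h𝒩 : ∀ Y ∈ F.image Prod.fst, Y = p.1 ∨ Touches adj p.1 Y := by
    intro Y hY
    obtain ⟨q, hq, rfl⟩ := mem_image.1 hY
    exact touches_of_tinc hR (mem_filter.1 hq).2
  have hX : (0 : ℝ) ≤ p.1.card := Nat.cast_nonneg _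
  show ∑ q ∈ F, kpTerm w (fun p => (p.1.card : ℝ)) q ≤ (p.1.card : ℝ)
  calc ∑ q ∈ F, kpTerm w (fun p => (p.1.card : ℝ)) q
      ≤ ∑ q ∈ F, kpWeight adj lam q.1 := sum_le_sum fun q _ => kpTerm_le_kpWeight hz0 hz q
    _ ≤ 2 * ∑ Y ∈ F.image Prod.fst, kpWeight adj lam Y := sum_typed_le_two_mul (fun X => kpWeight_nonneg adj hlam0 X) F
    _ ≤ 2 * (p.1.card * ((Δ : ℝ) + 1) * (2 * lam)) := by
        gcongr
        exact sum_kpWeight_le_of_touches hR hΔ hnbr hlam0 hsmall₁' p.1 _ h𝒩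
    _ = p.1.card * (4 * Real.exp 1 * ε * ((Δ : ℝ) + 1)) := by rw [hlam]; ring
    _ ≤ p.1.card * 1 := by gcongr
    _ = p.1.card := mul_one _

end Literature.MathematicalPhysics.QuantumFieldTheory.BalabanImbrieJaffe1984to88.BIJ88TypedGasKP
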